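import Literature.Combinatorics.SetFamily.SpreadLemma
import Mathlib.Algebra.Order.Field.GeomSum
import HarnessLib

/-!
# The spread lemma: Bell's halving process (deterministic part)

The iteration behind Bell's proof of the Park–Pham theorem with optimal `ε`-dependence
(Bell 2023, proof of Thm. 3), specialised to our use (a spread family `F`, Bell 2023, Lemma 10):
a *round* takes the current `l`-bounded family `H`, a fresh random set `W`, and replaces every
`S ∈ H` by its minimum fragment `T(S, W)`; if the *large* fragments (`|T| > l/2`) are cheap —
`∑ r^{-|T|} ≤ θ(l)`, the round *succeeds* — they are moved to the cover `U` and `l` is halved,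
otherwise (*failure*) the round only removes `W` from the sets and retries.

This file is measure-free: it defines the round map `step` and proves the invariant `Inv`
(boundedness, ancestry, the cover alternative, and the cost budget `cost U + Θ(l) ≤ Θ(l₀)`),
and the endgame `Inv.exists_subset_of_l_eq_zero`: once `l = 0`, spreadness of `F`
(`one_le_sum_inv_pow_of_cover`) and `Θ(l₀) < 1` force some member of `F` inside the union `V`
of the random sets used so far. The probabilistic part is in `SpreadLemmaProofs.lean`.

* `cost r U = ∑_{T ∈ U} r^{-|T|}`; `theta L l = 2 ∑_{l/2 < t ≤ l} (l choose t) L^{-t}` (success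
  threshold, twice the expectation bound of Park–Pham's counting lemma with `q' = L q`);
  `Theta L l = 2 ∑_{1 ≤ t ≤ l} (4/L)^t` (budget), `theta_add_Theta_half_le`, `Theta_le`.
* `RoundState`, `bigFrags`, `smallFrags`, `Succeeds`, `step`; `Inv`, `Inv.init`, `Inv.step`,
  `Inv.exists_subset_of_l_eq_zero`; `cost_bigFrags_eq_sum` (cost of the large fragments by size).

## References

* T. Bell, *The Park–Pham theorem with optimal convergence rate*, Electron. J. Combin. 30(2)
  (2023) P2.25, §2–§3 (proof of Thm. 3) [Bell2023].
* J. Park, H. T. Pham, *A proof of the Kahn–Kalai conjecture*, J. Amer. Math. Soc. 37 (2024), §2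
  [ParkPham2024].
-/

namespace Literature.Combinatorics.SetFamily

open Finset

variable {α : Type*} [DecidableEq α]

/-! ### Costs, thresholds, budgets -/

/-- The `q`-cost `∑_{T ∈ U} q^{|T|}` of a family, `q = 1/r` (Bell 2023, §1, `q`-small).
[cite: Bell2023, Def. 1] -/
noncomputable def cost (r : ℝ) (U : Finset (Finset α)) : ℝ := ∑ T ∈ U, (1 / r) ^ #T

omit [DecidableEq α] in
/-- Costs are nonnegative for `r ≥ 0`. [folklore] -/
theorem cost_nonneg {r : ℝ} (hr : 0 ≤ r) (U : Finset (Finset α)) : 0 ≤ cost r U :=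
  sum_nonneg fun T _ => pow_nonneg (by positivity) _

/-- The cost of a union is at most the sum of the costs. [folklore] -/
theorem cost_union_le {r : ℝ} (hr : 0 ≤ r) (U U' : Finset (Finset α)) :
    cost r (U ∪ U') ≤ cost r U + cost r U' := by
  unfold cost
  rw [← sum_union_inter]
  have : 0 ≤ ∑ T ∈ U ∩ U', (1 / r) ^ #T := sum_nonneg fun T _ => pow_nonneg (by positivity) _
  linarith

omit [DecidableEq α] in
/-- The cost of the empty family is `0`. [folklore] -/
@[simp] theorem cost_empty (r : ℝ) : cost r (∅ : Finset (Finset α)) = 0 := by simp [cost]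

/-- The success threshold of a round at level `l`: `θ(l) = 2 ∑_{l/2 < t ≤ l} (l choose t) L^{-t}`
(Bell 2023, proof of Thm. 3, failure criterion, with `8` replaced by `L`). [cite: Bell2023, Thm. 3] -/
noncomputable def theta (L : ℝ) (l : ℕ) : ℝ :=
  2 * ∑ t ∈ Ico (l / 2 + 1) (l + 1), (l.choose t : ℝ) * (1 / L) ^ t

/-- The cost budget at level `l`: `Θ(l) = 2 ∑_{1 ≤ t ≤ l} (4/L)^t`; the thresholds of the levels
`l, l/2, l/4, …` fit into it (`theta_add_Theta_half_le`) (Bell 2023, proof of Thm. 2/3, the bound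
`2 ∑_t 8^{-t} (2t-1 choose t) < 1/2`, in cruder form). [cite: Bell2023, Thm. 3] -/
noncomputable def Theta (L : ℝ) (l : ℕ) : ℝ := 2 * ∑ t ∈ Ico 1 (l + 1), (4 / L) ^ t

/-- `Θ(0) = 0`. [cite: Bell2023, Thm. 3] -/
@[simp] theorem Theta_zero (L : ℝ) : Theta L 0 = 0 := by simp [Theta]

/-- The threshold is positive at positive levels (the term `t = l` is `L^{-l} > 0`).
[cite: Bell2023, Thm. 3] -/
theorem theta_pos {L : ℝ} (hL : 0 < L) {l : ℕ} (hl : 1 ≤ l) : 0 < theta L l := by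
  unfold theta
  refine mul_pos two_pos ?_
  have hmem : l ∈ Ico (l / 2 + 1) (l + 1) := by
    rw [mem_Ico]; omega
  refine lt_of_lt_of_le ?_ (single_le_sum (f := fun t => (l.choose t : ℝ) * (1 / L) ^ t)
    (fun t _ => by positivity) hmem)
  simp only [Nat.choose_self, Nat.cast_one, one_mul]
  positivity

/-- **The thresholds fit the budget**: `θ(l) + Θ(l/2) ≤ Θ(l)`, because `(l choose t) ≤ 2^l ≤ 4^t`
for `t > l/2` and the ranges `(l/2, l]`, `[1, l/2]` partition `[1, l]`. [cite: Bell2023, Thm. 3] -/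
theorem theta_add_Theta_half_le {L : ℝ} (hL : 0 < L) (l : ℕ) :
    theta L l + Theta L (l / 2) ≤ Theta L l := by
  have h1 : theta L l ≤ 2 * ∑ t ∈ Ico (l / 2 + 1) (l + 1), (4 / L) ^ t := by
    unfold theta
    refine mul_le_mul_of_nonneg_left (sum_le_sum fun t ht => ?_) (by norm_num)
    rw [mem_Ico] at ht
    have hchoose : (l.choose t : ℝ) ≤ 4 ^ t := by
      have h2 : l.choose t ≤ 2 ^ l := Nat.choose_le_two_pow l t
      have h3 : (2 : ℕ) ^ l ≤ 4 ^ t := by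
        calc (2 : ℕ) ^ l ≤ 2 ^ (2 * t) := Nat.pow_le_pow_right (by norm_num) (by omega)
          _ = 4 ^ t := by rw [pow_mul]; norm_num
      exact_mod_cast h2.trans h3
    calc (l.choose t : ℝ) * (1 / L) ^ t ≤ 4 ^ t * (1 / L) ^ t :=
          mul_le_mul_of_nonneg_right hchoose (by positivity)
      _ = (4 / L) ^ t := by rw [← mul_pow]; ring
  have hunion : Ico 1 (l / 2 + 1) ∪ Ico (l / 2 + 1) (l + 1) = Ico 1 (l + 1) :=
    Ico_union_Ico_eq_Ico (by omega) (by omega)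
  have hdisj : Disjoint (Ico 1 (l / 2 + 1)) (Ico (l / 2 + 1) (l + 1)) :=
    Ico_disjoint_Ico_consecutive _ _ _
  unfold Theta
  rw [← hunion, sum_union hdisj]
  linarith

/-- **The budget is small**: `Θ(l) ≤ 8 / (L - 4)` for `L > 4` (geometric series); e.g. `< 1` for
`L ≥ 13`. [cite: Bell2023, Thm. 3] -/
theorem Theta_le {L : ℝ} (hL : 4 < L) (l : ℕ) : Theta L l ≤ 8 / (L - 4) := by
  unfold Theta
  have hx0 : 0 ≤ 4 / L := by positivity
  have hx1 : 4 / L < 1 := by rw [div_lt_one (by linarith)]; exact hL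
  have hgeom := geom_sum_Ico_le_of_lt_one hx0 hx1 (m := 1) (n := l + 1)
  rw [pow_one] at hgeom
  have heq : 4 / L / (1 - 4 / L) = 4 / (L - 4) := by
    have hL0 : L ≠ 0 := by linarith
    have hL4 : L - 4 ≠ 0 := by linarith
    field_simp
  rw [heq] at hgeom
  have : (8 : ℝ) / (L - 4) = 2 * (4 / (L - 4)) := by ring
  rw [this]
  exact mul_le_mul_of_nonneg_left hgeom (by norm_num)

/-! ### The round map -/

/-- The state of Bell's process: the current family `H`, the cover `U` collected from the
successful rounds, and the current size bound `l`. [cite: Bell2023, Thm. 3] -/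
structure RoundState (α : Type*) where
  /-- the current family (`l`-bounded) -/
  H : Finset (Finset α)
  /-- the cover collected so far -/
  U : Finset (Finset α)
  /-- the current size bound -/
  l : ℕ

/-- The large minimum fragments of a round: `𝒞 = {T(S, W) : S ∈ H, |T(S, W)| > l/2}`.
[cite: Bell2023, Thm. 3] -/
noncomputable def bigFrags (s : RoundState α) (W : Finset α) : Finset (Finset α) :=
  (s.H.image (frag s.H W)).filter fun T => s.l / 2 < #T

/-- The small minimum fragments of a round: `{T(S, W) : S ∈ H, |T(S, W)| ≤ l/2}` — the next
family after a successful round. [cite: Bell2023, Thm. 3] -/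
noncomputable def smallFrags (s : RoundState α) (W : Finset α) : Finset (Finset α) :=
  (s.H.image (frag s.H W)).filter fun T => #T ≤ s.l / 2

/-- A round *succeeds* if its large fragments are cheap: `∑_{T ∈ 𝒞} r^{-|T|} ≤ θ(l)`.
[cite: Bell2023, Thm. 3] -/
def Succeeds (r L : ℝ) (s : RoundState α) (W : Finset α) : Prop :=
  cost r (bigFrags s W) ≤ theta L s.l

open Classical in
/-- One round of Bell's process with the fresh set `W`: on success the large fragments join the
cover, the small ones form the next family and `l` is halved; on failure every set merely loses
`W` and `l` is kept. [cite: Bell2023, Thm. 3] -/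
noncomputable def step (r L : ℝ) (s : RoundState α) (W : Finset α) : RoundState α :=
  if Succeeds r L s W then ⟨smallFrags s W, s.U ∪ bigFrags s W, s.l / 2⟩
  else ⟨s.H.image fun S => S \ W, s.U, s.l⟩

/-- The round map on success. [cite: Bell2023, Thm. 3] -/
theorem step_of_succeeds {r L : ℝ} {s : RoundState α} {W : Finset α} (h : Succeeds r L s W) :
    step r L s W = ⟨smallFrags s W, s.U ∪ bigFrags s W, s.l / 2⟩ := by
  unfold step; rw [if_pos h]

/-- The round map on failure. [cite: Bell2023, Thm. 3] -/
theorem step_of_not_succeeds {r L : ℝ} {s : RoundState α} {W : Finset α} (h : ¬ Succeeds r L s W) :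
    step r L s W = ⟨s.H.image fun S => S \ W, s.U, s.l⟩ := by
  unfold step; rw [if_neg h]

open Classical in
/-- The level after a round is `l/2` on success and `l` on failure. [cite: Bell2023, Thm. 3] -/
theorem step_l (r L : ℝ) (s : RoundState α) (W : Finset α) :
    (step r L s W).l = if Succeeds r L s W then s.l / 2 else s.l := by
  by_cases h : Succeeds r L s W
  · rw [step_of_succeeds h, if_pos h]
  · rw [step_of_not_succeeds h, if_neg h]

/-- The cost of the large fragments, sorted by size: `∑_{T ∈ 𝒞} r^{-|T|} = ∑_{l/2 < t ≤ l} r^{-t}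
· #{T(S, W) : |T(S, W)| = t}` for an `l`-bounded family. [cite: Bell2023, Thm. 3] -/
theorem cost_bigFrags_eq_sum {r : ℝ} (s : RoundState α) (hbdd : ∀ S ∈ s.H, #S ≤ s.l) (W : Finset α) :
    cost r (bigFrags s W)
      = ∑ t ∈ Ico (s.l / 2 + 1) (s.l + 1), (1 / r) ^ t * #(fragsOfCard s.H W t) := by
  unfold cost
  have hmaps : ∀ T ∈ bigFrags s W, #T ∈ Ico (s.l / 2 + 1) (s.l + 1) := by
    intro T hT
    obtain ⟨hT1, hT2⟩ := mem_filter.1 hT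
    obtain ⟨S, hS, rfl⟩ := mem_image.1 hT1
    rw [mem_Ico]
    have := card_frag_le_of_bounded hbdd hS (W := W)
    omega
  rw [← sum_fiberwise_of_maps_to hmaps]
  refine sum_congr rfl fun t ht => ?_
  rw [mem_Ico] at ht
  have hset : (bigFrags s W).filter (fun T => #T = t) = fragsOfCard s.H W t := by
    ext T
    simp only [bigFrags, fragsOfCard, mem_filter, mem_image]
    constructor
    · rintro ⟨⟨h1, -⟩, h3⟩; exact ⟨h1, h3⟩
    · rintro ⟨h1, h3⟩; exact ⟨⟨h1, by omega⟩, h3⟩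
  rw [sum_congr rfl (g := fun T => (1 / r) ^ t) fun T hT => by rw [(mem_filter.1 hT).2], hset,
    sum_const, nsmul_eq_mul, mul_comm]

/-! ### The invariant -/

/-- The invariant of Bell's process after some rounds whose random sets have union `V`, for the
original family `F`, budget level `l₀` and state `s = (H, U, l)`:
`H` is `l`-bounded; every `S ∈ H` together with `V` contains a member of `F` (*ancestry*);
every `S₀ ∈ F` either is witnessed inside `V`, or contains a member of the cover `U`, or contains
a member of `H` (*cover alternative*); and the cost budget `cost U + Θ(l) ≤ Θ(l₀)`.
(Bell 2023, proof of Thm. 3: "either some `S ⊆ W` … or `𝒰` undercovers `H`", and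
`∑_{U ∈ 𝒰} q^{|U|} ≤ 2 ∑_t 8^{-t} (ℓ_{i(t)} choose t)`.) [cite: Bell2023, Thm. 3] -/
structure Inv (F : Finset (Finset α)) (r L : ℝ) (l₀ : ℕ) (s : RoundState α) (V : Finset α) :
    Prop where
  /-- the current family is `l`-bounded -/
  bdd : ∀ S ∈ s.H, #S ≤ s.l
  /-- ancestry: every current set plus the used elements contains an original set -/
  anc : ∀ S ∈ s.H, ∃ S₀ ∈ F, S₀ ⊆ S ∪ V
  /-- cover alternative for every original set -/
  cov : ∀ S₀ ∈ F, (∃ S₁ ∈ F, S₁ ⊆ V) ∨ (∃ T ∈ s.U, T ⊆ S₀) ∨ (∃ S ∈ s.H, S ⊆ S₀)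
  /-- cost budget -/
  cst : cost r s.U + Theta L s.l ≤ Theta L l₀

/-- The invariant holds initially for `(F, ∅, ℓ)` and `V = ∅`. [cite: Bell2023, Thm. 3] -/
theorem Inv.init {F : Finset (Finset α)} {ℓ : ℕ} (hF : ∀ S ∈ F, #S ≤ ℓ) (r L : ℝ) :
    Inv F r L ℓ ⟨F, ∅, ℓ⟩ ∅ where
  bdd := hF
  anc S hS := ⟨S, hS, subset_union_left⟩
  cov S₀ hS₀ := Or.inr (Or.inr ⟨S₀, hS₀, Subset.refl _⟩)
  cst := by simp

/-- **The invariant is preserved by a round** (with `V ↦ V ∪ W`). [cite: Bell2023, Thm. 3] -/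
theorem Inv.step {F : Finset (Finset α)} {r L : ℝ} {l₀ : ℕ} {s : RoundState α} {V : Finset α}
    (h : Inv F r L l₀ s V) (hr : 0 ≤ r) (hL : 0 < L) (W : Finset α) :
    Inv F r L l₀ (step r L s W) (V ∪ W) := by
  by_cases hs : Succeeds r L s W
  · rw [step_of_succeeds hs]
    refine ⟨?_, ?_, ?_, ?_⟩
    · intro T hT
      exact (mem_filter.1 hT).2
    · intro T hT
      obtain ⟨hT1, -⟩ := mem_filter.1 hT
      obtain ⟨S, hS, rfl⟩ := mem_image.1 hT1
      obtain ⟨S', hS', hsub, heq⟩ := exists_eq_frag (W := W) hS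
      obtain ⟨S₀, hS₀, hS₀sub⟩ := h.anc S' hS'
      refine ⟨S₀, hS₀, fun x hx => ?_⟩
      rw [heq]
      rcases mem_union.1 (hS₀sub hx) with hx' | hx'
      · by_cases hxW : x ∈ W
        · exact mem_union_right _ (mem_union_right _ hxW)
        · exact mem_union_left _ (mem_sdiff.2 ⟨hx', hxW⟩)
      · exact mem_union_right _ (mem_union_left _ hx')
    · intro S₀ hS₀
      rcases h.cov S₀ hS₀ with ⟨S₁, hS₁, hS₁V⟩ | ⟨T, hT, hTS⟩ | ⟨S, hS, hSS⟩
      · exact Or.inl ⟨S₁, hS₁, hS₁V.trans subset_union_left⟩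
      · exact Or.inr (Or.inl ⟨T, mem_union_left _ hT, hTS⟩)
      · have hTimg : frag s.H W S ∈ s.H.image (frag s.H W) := mem_image_of_mem _ hS
        have hTS₀ : frag s.H W S ⊆ S₀ := (frag_subset hS).trans hSS
        by_cases hbig : s.l / 2 < #(frag s.H W S)
        · exact Or.inr (Or.inl ⟨_, mem_union_right _ (mem_filter.2 ⟨hTimg, hbig⟩), hTS₀⟩)
        · exact Or.inr (Or.inr ⟨_, mem_filter.2 ⟨hTimg, not_lt.1 hbig⟩, hTS₀⟩)
    · have h1 := cost_union_le hr s.U (bigFrags s W)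
      have h2 := theta_add_Theta_half_le hL s.l
      have h3 := h.cst
      have h4 : cost r (bigFrags s W) ≤ theta L s.l := hs
      change cost r (s.U ∪ bigFrags s W) + Theta L (s.l / 2) ≤ Theta L l₀
      linarith
  · rw [step_of_not_succeeds hs]
    refine ⟨?_, ?_, ?_, h.cst⟩
    · intro T hT
      obtain ⟨S, hS, rfl⟩ := mem_image.1 hT
      exact (card_le_card sdiff_subset).trans (h.bdd S hS)
    · intro T hT
      obtain ⟨S, hS, rfl⟩ := mem_image.1 hT
      obtain ⟨S₀, hS₀, hS₀sub⟩ := h.anc S hS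
      refine ⟨S₀, hS₀, fun x hx => ?_⟩
      rcases mem_union.1 (hS₀sub hx) with hx' | hx'
      · by_cases hxW : x ∈ W
        · exact mem_union_right _ (mem_union_right _ hxW)
        · exact mem_union_left _ (mem_sdiff.2 ⟨hx', hxW⟩)
      · exact mem_union_right _ (mem_union_left _ hx')
    · intro S₀ hS₀
      rcases h.cov S₀ hS₀ with ⟨S₁, hS₁, hS₁V⟩ | ⟨T, hT, hTS⟩ | ⟨S, hS, hSS⟩
      · exact Or.inl ⟨S₁, hS₁, hS₁V.trans subset_union_left⟩
      · exact Or.inr (Or.inl ⟨T, hT, hTS⟩)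
      · exact Or.inr (Or.inr ⟨S \ W, mem_image_of_mem _ hS, sdiff_subset.trans hSS⟩)

/-- **Endgame** (Bell 2023, end of the proof of Thm. 3, with Lemma 10): if the level has dropped
to `0` then some member of the nonempty `r`-spread family `F` lies inside the used elements `V` —
otherwise the cover `U` would undercover `F` at cost `≤ Θ(l₀) < 1`, contradicting
`one_le_sum_inv_pow_of_cover`. [cite: Bell2023, Thm. 3] -/
theorem Inv.exists_subset_of_l_eq_zero {F : Finset (Finset α)} {r L : ℝ} {l₀ : ℕ}
    {s : RoundState α} {V : Finset α} (h : Inv F r L l₀ s V) (hl : s.l = 0) (hF : F.Nonempty)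
    (hsp : IsSpread r F) (hΘ : Theta L l₀ < 1) : ∃ S ∈ F, S ⊆ V := by
  by_contra hne
  push Not at hne
  have hcover : ∀ S₀ ∈ F, ∃ T ∈ s.U, T ⊆ S₀ := by
    intro S₀ hS₀
    rcases h.cov S₀ hS₀ with ⟨S₁, hS₁, hS₁V⟩ | hT | ⟨S, hS, hSS⟩
    · exact absurd hS₁V (hne S₁ hS₁)
    · exact hT
    · have hS0 : S = ∅ := card_eq_zero.1 (Nat.le_zero.1 (hl ▸ h.bdd S hS))
      obtain ⟨S₁, hS₁, hS₁sub⟩ := h.anc S hS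
      rw [hS0, empty_union] at hS₁sub
      exact absurd hS₁sub (hne S₁ hS₁)
  have h1 : 1 ≤ cost r s.U := one_le_sum_inv_pow_of_cover hF hsp s.U hcover
  have h2 := h.cst
  rw [hl, Theta_zero, add_zero] at h2
  linarith

end Literature.Combinatorics.SetFamily
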